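import Summits.Parity.GeneralizedHardyLittlewood.Theorems.LiouvilleShiftedTablesSieveToMAvgI2Local

/-!
# Sieve glue for `SieveToMAvg`, part 7c: Type I₂ — expanding a triple product and slicing

Support file for item stmt-Parity-14274 (route `LiouvilleShiftedTables`).  A non-Type-II box tuple
is a triple Dirichlet product `γ ⋆ 𝟙_{(s₁,s₂]} ⋆ 𝟙_{(n₁,n₂]}` (`γ` = the small slots, the two
indicators = the big smooth slots, or `(0,1]` and the single big slot).  Its correlation sum is

  `corr_q = ∑_r γ(r) ∑_{s₁ < s ≤ s₂} boxCrossSum(q, r, s)`   (`corr_triple_eq`).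

Slicing `r` (through `boxRestrict R Δ ρ γ`) and `s` (pieces `(a_i, b_i]` of ratio `1+Δ`) and
applying the local decomposition of part 7b on each slice gives `abs_corr_triple_le`:
`|corr_q| ≤ ∑_{ρ,i} ∑_r |γ_ρ(r)| (four |Dsum| corners) + ∑_r |γ(r)| ∑_s (thin-set counts)`.
-/

namespace Summit.Parity.GeneralizedHardyLittlewood.Theorems.SieveToMAvg

open Finset Real
open scoped ArithmeticFunction.zeta ArithmeticFunction.sigma
open Literature.NumberTheory.Sieve.BFI

/-! ### Interval indicators as arithmetic functions -/

/-- The indicator of the naturals in `(a, b]` (and `≥ 1`), as an arithmetic function. [folklore] -/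
noncomputable def indAF (a b : ℝ) : ArithmeticFunction ℝ where
  toFun n := if 0 < n ∧ a < (n : ℝ) ∧ (n : ℝ) ≤ b then 1 else 0
  map_zero' := by simp

/-- Unfolding `indAF`. [folklore] -/
theorem indAF_apply (a b : ℝ) (n : ℕ) : indAF a b n = if 0 < n ∧ a < (n : ℝ) ∧ (n : ℝ) ≤ b then 1 else 0 := rfl

/-- `|indAF a b n| ≤ 1`. [folklore] -/
theorem abs_indAF_le_one (a b : ℝ) (n : ℕ) : |indAF a b n| ≤ 1 := by
  rw [indAF_apply]; split_ifs <;> simp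

section Expand

variable (h q : ℕ) (x : ℝ) (γ : ArithmeticFunction ℝ) (s₁ s₂ n₁ n₂ : ℝ)

/-- The `s`-sum `T(q, r) = ∑_{s ≤ 2x, s₁ < s ≤ s₂} boxCrossSum(q, r, s)`. [folklore] -/
noncomputable def Tsum (r : ℕ) : ℝ :=
  ∑ s ∈ Ioc 0 ⌊2 * x⌋₊, indAF s₁ s₂ s * boxCrossSum h q r s x n₁ n₂

variable {h q x γ s₁ s₂ n₁ n₂}

/-- The inner `n'`-sum of the expansion is `boxCrossSum`: for `n' ≥ 1`,
`indAF n₁ n₂ n' · cc(rsn') = 1_{n₁<n'≤n₂} 1_{⌊x⌋<rsn'≤⌊2x⌋, rsn'≡h} λ(rsn' − h)`. [folklore] -/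
theorem sum_indAF_mul_cc_eq (r s : ℕ) :
    ∑ n ∈ Ioc 0 ⌊2 * x⌋₊, indAF n₁ n₂ n * cc h q x ⌊2 * x⌋₊ (r * s * n) = boxCrossSum h q r s x n₁ n₂ := by
  unfold boxCrossSum
  refine Finset.sum_congr rfl fun n hn => ?_
  have hn0 : 0 < n := (Finset.mem_Ioc.1 hn).1
  rw [indAF_apply]
  unfold cc
  by_cases hb : n₁ < (n : ℝ) ∧ (n : ℝ) ≤ n₂
  · rw [if_pos ⟨hn0, hb⟩, one_mul]
    by_cases hc : ⌊x⌋₊ < r * s * n ∧ r * s * n ≤ ⌊2 * x⌋₊ ∧ r * s * n ≡ h [MOD q]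
    · rw [if_pos hc, if_pos ⟨hb, hc⟩]
    · rw [if_neg hc, if_neg (fun h' => hc h'.2)]
  · rw [if_neg (fun h' => hb h'.2), zero_mul, if_neg (fun h' => hb h'.1)]

/-- **Expansion of the triple product**:
`corr_q(γ ⋆ indAF s₁ s₂ ⋆ indAF n₁ n₂) = ∑_{r ≤ 2x} γ(r) T(q, r)`. [folklore] -/
theorem corr_triple_eq :
    corr (lamW h) h q x (fun n => (γ * indAF s₁ s₂ * indAF n₁ n₂) n) =
      ∑ r ∈ Ioc 0 ⌊2 * x⌋₊, γ r * Tsum h q x s₁ s₂ n₁ n₂ r := by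
  set N := ⌊2 * x⌋₊ with hN
  rw [corr_mul_eq]
  -- `∑_m (γ ⋆ ι_S)(m) W(m)` with `W(m) = ∑_{n'} ι_N(n') cc(m n')`
  set W : ℕ → ℝ := fun m => ∑ n ∈ Ioc 0 N, indAF n₁ n₂ n * cc h q x N (m * n) with hW
  have h1 : ∑ a ∈ Ioc 0 N, ∑ b ∈ Ioc 0 N, (γ * indAF s₁ s₂) a * indAF n₁ n₂ b * cc h q x N (a * b) =
      ∑ a ∈ Ioc 0 N, (γ * indAF s₁ s₂) a * W a := by
    refine Finset.sum_congr rfl fun a _ => ?_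
    rw [hW, Finset.mul_sum]
    exact Finset.sum_congr rfl fun b _ => by ring
  rw [h1, sum_Ioc_mul_apply_mul, Finset.sum_filter, Finset.sum_product]
  unfold Tsum
  refine Finset.sum_congr rfl fun r hr => ?_
  rw [Finset.mul_sum]
  refine Finset.sum_congr rfl fun s hs => ?_
  have hr0 : 0 < r := (Finset.mem_Ioc.1 hr).1
  have hs0 : 0 < s := (Finset.mem_Ioc.1 hs).1
  by_cases hrs : r * s ≤ N
  · rw [if_pos hrs, hW]
    simp only
    rw [sum_indAF_mul_cc_eq]
    ring
  · rw [if_neg hrs]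
    -- `W(rs) = 0` (every `cc(rs n')` vanishes since `rs n' > N`), so the summand is `0`
    have hW0 : boxCrossSum h q r s x n₁ n₂ = 0 := by
      unfold boxCrossSum
      refine Finset.sum_eq_zero fun n hn => ?_
      have hn0 : 0 < n := (Finset.mem_Ioc.1 hn).1
      rw [if_neg]
      rintro ⟨-, -, hle, -⟩
      apply hrs
      calc r * s ≤ r * s * n := Nat.le_mul_of_pos_right _ hn0
        _ ≤ N := hle
    rw [hW0, mul_zero, mul_zero]

end Expand

/-! ### The `s`-pieces -/

section Pieces

variable (s₁ s₂ Δ : ℝ)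

/-- The left end of the `i`-th `s`-piece: `a_i = min (max lo_i s₁) hi_i`. [folklore] -/
noncomputable def sA (i : ℕ) : ℝ := min (max (boxLow s₂ Δ i) s₁) (boxHigh s₂ Δ i)

/-- The right end of the `i`-th `s`-piece: `b_i = hi_i`. [folklore] -/
noncomputable def sB (i : ℕ) : ℝ := boxHigh s₂ Δ i

variable {s₁ s₂ Δ}

/-- `a_i ≤ b_i`. [folklore] -/
theorem sA_le_sB (i : ℕ) : sA s₁ s₂ Δ i ≤ sB s₂ Δ i := min_le_right _ _

/-- `lo_i ≤ a_i` (`Δ ≥ 0`, `s₂ ≥ 0`). [folklore] -/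
theorem boxLow_le_sA (hs₂ : 0 ≤ s₂) (hΔ : 0 ≤ Δ) (i : ℕ) : boxLow s₂ Δ i ≤ sA s₁ s₂ Δ i := by
  unfold sA
  refine le_min (le_max_left _ _) ?_
  rw [boxHigh_eq_mul_boxLow (by linarith : (-1 : ℝ) < Δ)]
  have : 0 ≤ boxLow s₂ Δ i := by unfold boxLow; positivity
  nlinarith

/-- `s₁ ≤ a_i` or the piece is empty (`a_i = b_i`): in all cases `a_i < s ≤ b_i` implies `s₁ < s`. [folklore] -/
theorem lt_of_mem_piece {i : ℕ} {s : ℝ} (h1 : sA s₁ s₂ Δ i < s) (h2 : s ≤ sB s₂ Δ i) : s₁ < s := by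
  unfold sA at h1
  unfold sB at h2
  rcases le_total (max (boxLow s₂ Δ i) s₁) (boxHigh s₂ Δ i) with hle | hle
  · rw [min_eq_left hle] at h1
    exact lt_of_le_of_lt (le_max_right _ _) h1
  · rw [min_eq_right hle] at h1
    linarith

/-- Membership in the `i`-th piece: for `s ≥ 1`, `0 < s₂`, `0 < Δ`,
`(⌊a_i⌋ < s ∧ s ≤ ⌊b_i⌋) ↔ (InBox s₂ Δ i s ∧ s₁ < s)`. [folklore] -/
theorem mem_piece_iff (hs₂ : 0 < s₂) (hΔ : 0 < Δ) (i : ℕ) {s : ℕ} (hs : 0 < s) :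
    (⌊sA s₁ s₂ Δ i⌋₊ < s ∧ s ≤ ⌊sB s₂ Δ i⌋₊) ↔ (InBox s₂ Δ i s ∧ s₁ < s) := by
  have hlo0 : 0 < boxLow s₂ Δ i := boxLow_pos hs₂ (by linarith) i
  have hhi0 : 0 < boxHigh s₂ Δ i := by unfold boxHigh; positivity
  have hA0 : 0 ≤ sA s₁ s₂ Δ i := le_min (le_max_of_le_left hlo0.le) hhi0.le
  unfold sB
  rw [Nat.floor_lt hA0, Nat.le_floor_iff hhi0.le]
  unfold InBox
  constructor
  · rintro ⟨h1, h2⟩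
    have hs₁s : s₁ < s := lt_of_mem_piece h1 h2
    refine ⟨⟨hs, ?_, h2⟩, hs₁s⟩
    exact lt_of_le_of_lt (boxLow_le_sA hs₂.le hΔ.le i) h1
  · rintro ⟨⟨-, h1, h2⟩, h3⟩
    refine ⟨?_, h2⟩
    unfold sA
    exact lt_of_le_of_lt (min_le_left _ _) (max_lt h1 h3)

/-- **Slicing the `s`-sum**: for `0 < s₂ ≤ 2x`, `s₂ < (1+Δ)^{K_s}`, `Δ > 0`, and any `F`,
`∑_{s ≤ 2x} indAF s₁ s₂ s · F(s) = ∑_{i<K_s} ∑_{s ∈ Ioc ⌊a_i⌋ ⌊b_i⌋} F(s)`. [folklore] -/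
theorem sum_indAF_mul_eq_sum_pieces {x : ℝ} (hs₂ : 0 < s₂) (hs₂x : s₂ ≤ 2 * x) (hΔ : 0 < Δ)
    {K_s : ℕ} (hKs : s₂ < (1 + Δ) ^ K_s) (F : ℕ → ℝ) :
    ∑ s ∈ Ioc 0 ⌊2 * x⌋₊, indAF s₁ s₂ s * F s =
      ∑ i ∈ Finset.range K_s, ∑ s ∈ Ioc ⌊sA s₁ s₂ Δ i⌋₊ ⌊sB s₂ Δ i⌋₊, F s := by
  classical
  -- write each piece sum as a filtered sum over `Ioc 0 ⌊2x⌋`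
  have hpiece : ∀ i ∈ Finset.range K_s, ∑ s ∈ Ioc ⌊sA s₁ s₂ Δ i⌋₊ ⌊sB s₂ Δ i⌋₊, F s =
      ∑ s ∈ Ioc 0 ⌊2 * x⌋₊, if InBox s₂ Δ i s ∧ s₁ < s then F s else 0 := by
    intro i _
    rw [← Finset.sum_filter]
    refine Finset.sum_congr ?_ fun _ _ => rfl
    ext s
    rw [Finset.mem_Ioc, Finset.mem_filter, Finset.mem_Ioc]
    constructor
    · rintro ⟨h1, h2⟩
      have hs : 0 < s := by omega
      have hm := (mem_piece_iff hs₂ hΔ i hs).1 ⟨h1, h2⟩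
      refine ⟨⟨hs, Nat.le_floor ?_⟩, hm⟩
      have : (s : ℝ) ≤ boxHigh s₂ Δ i := hm.1.2.2
      have hhi : boxHigh s₂ Δ i ≤ s₂ := by
        unfold boxHigh; exact div_le_self hs₂.le (one_le_pow₀ (by linarith))
      linarith
    · rintro ⟨⟨hs, -⟩, hm⟩
      exact (mem_piece_iff hs₂ hΔ i hs).2 hm
  rw [Finset.sum_congr rfl hpiece, Finset.sum_comm]
  refine Finset.sum_congr rfl fun s hs => ?_
  have hs0 : 0 < s := (Finset.mem_Ioc.1 hs).1
  rw [indAF_apply]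
  by_cases hin : s₁ < (s : ℝ) ∧ (s : ℝ) ≤ s₂
  · rw [if_pos ⟨hs0, hin⟩, one_mul]
    -- exactly one box contains `s`
    have hsum := sum_boxRestrict_apply (T := s₂) (Δ := Δ) hs₂ hΔ hKs (ζ : ArithmeticFunction ℝ) hs0 hin.2
    rw [ArithmeticFunction.natCoe_apply, ArithmeticFunction.zeta_apply_ne hs0.ne', Nat.cast_one] at hsum
    calc F s = (∑ k ∈ Finset.range K_s, boxRestrict s₂ Δ k (ζ : ArithmeticFunction ℝ) s) * F s := by
          rw [hsum, one_mul]
      _ = ∑ k ∈ Finset.range K_s, boxRestrict s₂ Δ k (ζ : ArithmeticFunction ℝ) s * F s := Finset.sum_mul _ _ _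
      _ = ∑ i ∈ Finset.range K_s, if InBox s₂ Δ i s ∧ s₁ < s then F s else 0 := by
          refine Finset.sum_congr rfl fun k _ => ?_
          rw [boxRestrict_apply]
          by_cases hb : InBox s₂ Δ k s
          · rw [if_pos hb, if_pos ⟨hb, hin.1⟩, ArithmeticFunction.natCoe_apply,
              ArithmeticFunction.zeta_apply_ne hs0.ne', Nat.cast_one, one_mul]
          · rw [if_neg hb, if_neg (fun h' => hb h'.1), zero_mul]
  · rw [if_neg (fun h' => hin h'.2), zero_mul]
    symm
    refine Finset.sum_eq_zero fun i _ => ?_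
    rw [if_neg]
    rintro ⟨hb, h1⟩
    apply hin
    refine ⟨h1, hb.2.2.trans ?_⟩
    unfold boxHigh; exact div_le_self hs₂.le (one_le_pow₀ (by linarith))

end Pieces

end Summit.Parity.GeneralizedHardyLittlewood.Theorems.SieveToMAvg
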